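import Summits.MatrixMultiplication.MatrixMultiplication.Theorems.OutsiderSandwichRelativeTwist
import HarnessLib

/-!
# Coherent certificates cannot reach the leaf: sharing at most square-roots the count

Route `OutsiderSandwich` (decomposition cell `decomp-mm`, lens 4 «minimal counterexample /
extremal reduction», gen 27, kernel 8), support for the aside leaf `BlockOneIsMM`
(stmt-MatrixMultiplication-27147: `θ⋆ = 0`); cut of record untouched; theorem-only.

## The statement

WIRING NORMAL FORM (general restriction certificates).  A restriction
`⟨2^N,2^N,2^N⟩ ≤ ⊕_{i ∈ ι} C₁^{⊠N}` consists of: an `x`-leg map `A i` per copy (ONE matrix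
`A_i X` feeds all `2^N` blocks of copy `i`), and per block `(i, c)` a `y`-leg `L i c : Y ↦ v ∈ K^{2^N}`
and an output leg `R i c : K^{2^N} → M_{2^N}`; block `(i, c)` computes `τ_c(A_i X) · v`; the
certificate identity is `Σ_{(i,c) ∈ T} R_{i,c}(τ_c(A_i X) · L_{i,c} Y) = X · Y` for all `X, Y`
(`T` = the wired blocks).  Nothing is assumed about how blocks share output columns or mix input
columns — `OutsiderSandwichColumnDisjoint` was the column-disjoint special case,
`OutsiderSandwichSharedBlocks` priced sharing with a multiplicity factor `m`.

COHERENT = every two wired blocks of the same copy are relatively sign-untwisted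
(`τ_{c+c'}` is a scalar on `range A_i`; `OutsiderSandwichRelativeTwist`), i.e. each copy reads its
`x`-leg in ONE orientation up to signs.

* `four_pow_le_sq_card_mul_three_pow` — **a coherent certificate has `4^N ≤ |ι|² · 3^N`**, i.e.
  `|ι| ≥ (4/3)^{N/2}`, rate `≥ ½ · log₂(4/3) = 0.2075…` (`coherent_rate`), WHATEVER the sharing.
* `exists_incoherent_copy_of_lt` — EXTREMAL READING: a certificate with `|ι|² · 3^N < 4^N` has an
  INCOHERENT copy: one `x`-leg read in two non-proportional orientations.
* Consequence for the leaf (memo-level, the bridge `Helped` → wiring normal form being by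
  inspection): `BlockOneIsMM` (`θ⋆ = 0`), indeed any exchange rate `θ < 0.2075`, can only be
  witnessed by certificate families with incoherent copies — genuinely twisted use of the shared
  `x`-leg is NECESSARY, block sharing alone is not enough.  (Whether the square root is an artefact —
  i.e. whether coherent certificates are already capped at rate `log₂(4/3)` like column-disjoint
  ones — is open.)

## The proof (two flattenings and an orthogonality count)

For a set `S` of copies let `W := ⋂_{i ∈ S} ker A_i` (`dim W ≥ 4^N − Σ_{i∈S} rank A_i`) and
`𝓛 := ⋂_{(i,c) ∈ T, i ∉ S} ker L_{i,c}` (`dim 𝓛 ≥ 4^N − 2^N · #{wired blocks outside S}`).  For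
`X ∈ W`, `Y ∈ 𝓛` every term of the identity vanishes, so `X · Y = 0`; two spaces of matrices with
`W · 𝓛 = 0` have `dim W + dim 𝓛 ≤ 4^N` (`finrank_add_finrank_le_of_mul_eq_zero`: `𝓛` maps into the
joint column space `U`, `W` kills `U`).  Hence `Σ_{i∈S} rank A_i + 2^N · #{wired blocks outside S} ≥ 4^N`
for EVERY `S`; choosing `S` copy by copy gives `Σ_i min(rank A_i, 2^N k_i) ≥ 4^N` (`k_i` = wired
blocks of copy `i`), and coherence gives the capacity bound `k_i · rank A_i ≤ 6^N`
(`card_mul_finrank_range_le_of_relative`), so each `min ≤ √(12^N)` and `4^N ≤ |ι| · √(12^N)`.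

## References

* M. Bläser, *Fast Matrix Multiplication*, Theory of Computing Graduate Surveys 5 (2013), §5–6
  (restrictions of matrix multiplication tensors; substitution-type arguments). [Blaser2013]
* P. Bürgisser, M. Clausen, M. A. Shokrollahi, *Algebraic Complexity Theory* (1997), Ch. 14–15.
  [BurgisserClausenShokrollahi1997]
-/

noncomputable section

open scoped BigOperators Matrix

set_option linter.dupNamespace false
set_option autoImplicit false

namespace Summit.MatrixMultiplication.MatrixMultiplication.Theorems.OutsiderSandwichCoherentSharing

open Summit.MatrixMultiplication.MatrixMultiplication.Theorems.OutsiderSandwichTwistGluing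
  Summit.MatrixMultiplication.MatrixMultiplication.Theorems.OutsiderSandwichTwistCapacity
  Summit.MatrixMultiplication.MatrixMultiplication.Theorems.OutsiderSandwichColumnDisjoint
  Summit.MatrixMultiplication.MatrixMultiplication.Theorems.OutsiderSandwichRelativeTwist

universe u v w

/-! ## 1. Two linear-algebra counts -/

section LinearAlgebra

variable {K : Type u} [Field K]

/-- **Orthogonal spaces of matrices.**  If `X * Y = 0` for all `X ∈ W`, `Y ∈ L` (two subspaces of
`n × n` matrices), then `dim W + dim L ≤ n²`: `L` lies in `Hom(Kⁿ, U)` and `W` in `Hom(Kⁿ/U, Kⁿ)`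
for the joint column space `U` of `L`. -/
theorem finrank_add_finrank_le_of_mul_eq_zero {n : Type w} [Fintype n]
    (W L : Submodule K (Matrix n n K)) (h : ∀ X ∈ W, ∀ Y ∈ L, X * Y = 0) :
    Module.finrank K W + Module.finrank K L ≤ Fintype.card n * Fintype.card n := by
  classical
  -- pass to endomorphisms of `V = n → K`
  let V := n → K
  let e : Matrix n n K ≃ₗ[K] (V →ₗ[K] V) := Matrix.toLin'
  let W' : Submodule K (V →ₗ[K] V) := W.map (e : Matrix n n K →ₗ[K] (V →ₗ[K] V))
  let L' : Submodule K (V →ₗ[K] V) := L.map (e : Matrix n n K →ₗ[K] (V →ₗ[K] V))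
  have hW' : Module.finrank K W' = Module.finrank K W := LinearEquiv.finrank_map_eq e W
  have hL' : Module.finrank K L' = Module.finrank K L := LinearEquiv.finrank_map_eq e L
  have hcomp : ∀ f ∈ W', ∀ g ∈ L', f ∘ₗ g = 0 := by
    intro f hf g hg
    obtain ⟨X, hX, rfl⟩ := Submodule.mem_map.1 hf
    obtain ⟨Y, hY, rfl⟩ := Submodule.mem_map.1 hg
    show Matrix.toLin' X ∘ₗ Matrix.toLin' Y = 0
    rw [← Matrix.toLin'_mul, h X hX Y hY, map_zero]
  -- the joint column space of `L'`
  let U : Submodule K V := Submodule.span K {v | ∃ g ∈ L', ∃ w, g w = v}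
  have hLU : ∀ g ∈ L', ∀ w, g w ∈ U := fun g hg w => Submodule.subset_span ⟨g, hg, w, rfl⟩
  have hWU : ∀ f ∈ W', U ≤ LinearMap.ker f := by
    intro f hf
    rw [Submodule.span_le]
    rintro v ⟨g, hg, w, rfl⟩
    simp only [SetLike.mem_coe, LinearMap.mem_ker]
    have := LinearMap.congr_fun (hcomp f hf g hg) w
    simpa using this
  -- `L' ≤ Hom(V, U)` and `W' ≤ Hom(V ⧸ U, V)` (as images inside `End V`)
  let φ : (V →ₗ[K] U) →ₗ[K] (V →ₗ[K] V) := LinearMap.llcomp K V U V U.subtype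
  have hLφ : L' ≤ LinearMap.range φ := by
    intro g hg
    refine ⟨LinearMap.codRestrict U g (hLU g hg), ?_⟩
    change U.subtype ∘ₗ LinearMap.codRestrict U g (hLU g hg) = g
    exact LinearMap.subtype_comp_codRestrict g U (hLU g hg)
  let ψ : ((V ⧸ U) →ₗ[K] V) →ₗ[K] (V →ₗ[K] V) := LinearMap.lcomp K V U.mkQ
  have hWψ : W' ≤ LinearMap.range ψ := by
    intro f hf
    refine ⟨U.liftQ f (hWU f hf), ?_⟩
    change U.liftQ f (hWU f hf) ∘ₗ U.mkQ = f
    exact Submodule.liftQ_mkQ U f (hWU f hf)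
  have h1 : Module.finrank K L' ≤ Fintype.card n * Module.finrank K U := by
    calc Module.finrank K L' ≤ Module.finrank K (LinearMap.range φ) := Submodule.finrank_mono hLφ
      _ ≤ Module.finrank K (V →ₗ[K] U) := LinearMap.finrank_range_le φ
      _ = Module.finrank K V * Module.finrank K U := Module.finrank_linearMap K K V U
      _ = Fintype.card n * Module.finrank K U := by rw [Module.finrank_fintype_fun_eq_card]
  have h2 : Module.finrank K W' ≤ Module.finrank K (V ⧸ U) * Fintype.card n := by
    calc Module.finrank K W' ≤ Module.finrank K (LinearMap.range ψ) := Submodule.finrank_mono hWψ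
      _ ≤ Module.finrank K ((V ⧸ U) →ₗ[K] V) := LinearMap.finrank_range_le ψ
      _ = Module.finrank K (V ⧸ U) * Module.finrank K V := Module.finrank_linearMap K K (V ⧸ U) V
      _ = Module.finrank K (V ⧸ U) * Fintype.card n := by rw [Module.finrank_fintype_fun_eq_card]
  have h3 : Module.finrank K (V ⧸ U) + Module.finrank K U = Fintype.card n := by
    rw [Submodule.finrank_quotient_add_finrank, Module.finrank_fintype_fun_eq_card]
  rw [← hW', ← hL']
  calc Module.finrank K W' + Module.finrank K L'
      ≤ Module.finrank K (V ⧸ U) * Fintype.card n + Fintype.card n * Module.finrank K U :=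
        Nat.add_le_add h2 h1
    _ = Fintype.card n * Fintype.card n := by
        rw [Nat.mul_comm (Module.finrank K (V ⧸ U)), ← Nat.mul_add, h3]

/-- **Rank–nullity for a finite intersection of kernels:**
`dim M ≤ dim (⋂_{i∈S} ker fᵢ) + Σ_{i∈S} rank fᵢ`. -/
theorem finrank_le_finrank_inf_ker_add {σ : Type v} {M : Type w} {M' : Type*} [AddCommGroup M]
    [Module K M] [FiniteDimensional K M] [AddCommGroup M'] [Module K M'] (f : σ → M →ₗ[K] M')
    (S : Finset σ) :
    Module.finrank K M ≤ Module.finrank K ↥(S.inf fun i => LinearMap.ker (f i)) +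
      ∑ i ∈ S, Module.finrank K (LinearMap.range (f i)) := by
  classical
  induction S using Finset.induction_on with
  | empty => rw [Finset.inf_empty, finrank_top]; simp
  | @insert j S hj ih =>
      rw [Finset.inf_insert, Finset.sum_insert hj]
      have h1 := Submodule.finrank_sup_add_finrank_inf_eq (LinearMap.ker (f j))
        (S.inf fun i => LinearMap.ker (f i))
      have h2 := Submodule.finrank_le (LinearMap.ker (f j) ⊔ S.inf fun i => LinearMap.ker (f i))
      have h3 := LinearMap.finrank_range_add_finrank_ker (f j)
      omega

end LinearAlgebra

/-! ## 2. Coherent certificates: `4^N ≤ |ι|² · 3^N` -/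

variable {N : ℕ} {K : Type u} [Field K] {ι : Type v}

/-- **Subset constraint (no coherence needed).**  In any wiring with identity
`Σ_{(i,c) ∈ T} R_{i,c}(τ_c(A_i X) · L_{i,c} Y) = X · Y`, for every set `S` of copies:
`4^N ≤ Σ_{i∈S} rank A_i + 2^N · #{(i,c) ∈ T : i ∉ S}` — kill the copies of `S` on the `X` side and
the remaining wired blocks on the `Y` side; what is left multiplies to zero. -/
theorem four_pow_le_sum_finrank_add [DecidableEq ι]
    (A : ι → Matrix (Idx N) (Idx N) K →ₗ[K] Matrix (Idx N) (Idx N) K) (T : Finset (ι × Idx N))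
    (L : ι → Idx N → (Matrix (Idx N) (Idx N) K →ₗ[K] (Idx N → K)))
    (R : ι → Idx N → ((Idx N → K) →ₗ[K] Matrix (Idx N) (Idx N) K))
    (ident : ∀ X Y : Matrix (Idx N) (Idx N) K,
      ∑ b ∈ T, R b.1 b.2 (Matrix.mulVec (ptrans b.2 (A b.1 X)) (L b.1 b.2 Y)) = X * Y)
    (S : Finset ι) :
    4 ^ N ≤ ∑ i ∈ S, Module.finrank K (LinearMap.range (A i)) +
      2 ^ N * (T.filter fun b : ι × Idx N => b.1 ∉ S).card := by
  classical
  have hM : Module.finrank K (Matrix (Idx N) (Idx N) K) = 4 ^ N := finrank_matrix_Idx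
  have hV : Module.finrank K (Idx N → K) = 2 ^ N := by
    rw [Module.finrank_fintype_fun_eq_card, card_Idx]
  set W : Submodule K (Matrix (Idx N) (Idx N) K) := S.inf fun i => LinearMap.ker (A i) with hWdef
  set TS : Finset (ι × Idx N) := T.filter fun b : ι × Idx N => b.1 ∉ S with hTS
  set Lk : Submodule K (Matrix (Idx N) (Idx N) K) :=
    TS.inf fun b => LinearMap.ker (L b.1 b.2) with hLkdef
  have hW : 4 ^ N ≤ Module.finrank K W + ∑ i ∈ S, Module.finrank K (LinearMap.range (A i)) := by
    have h := finrank_le_finrank_inf_ker_add A S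
    rwa [hM] at h
  have hL : 4 ^ N ≤ Module.finrank K Lk + 2 ^ N * TS.card := by
    have h1 := finrank_le_finrank_inf_ker_add (fun b : ι × Idx N => L b.1 b.2) TS
    rw [hM] at h1
    have h2 : ∑ b ∈ TS, Module.finrank K (LinearMap.range (L b.1 b.2)) ≤ 2 ^ N * TS.card := by
      calc ∑ b ∈ TS, Module.finrank K (LinearMap.range (L b.1 b.2)) ≤ ∑ _b ∈ TS, 2 ^ N :=
            Finset.sum_le_sum fun b _ => by rw [← hV]; exact Submodule.finrank_le _
        _ = 2 ^ N * TS.card := by rw [Finset.sum_const, smul_eq_mul, mul_comm]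
    exact h1.trans (Nat.add_le_add_left h2 _)
  have horth : ∀ X ∈ W, ∀ Y ∈ Lk, X * Y = 0 := by
    intro X hX Y hY
    rw [← ident X Y]
    refine Finset.sum_eq_zero fun b hb => ?_
    by_cases hbS : b.1 ∈ S
    · have hA : A b.1 X = 0 := LinearMap.mem_ker.1 (Submodule.mem_finsetInf.1 hX b.1 hbS)
      rw [hA, ptrans_zero_matrix, Matrix.zero_mulVec, map_zero]
    · have hbT : b ∈ TS := Finset.mem_filter.2 ⟨hb, hbS⟩
      have hLY : L b.1 b.2 Y = 0 := LinearMap.mem_ker.1 (Submodule.mem_finsetInf.1 hY b hbT)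
      rw [hLY, Matrix.mulVec_zero, map_zero]
  have hWL := finrank_add_finrank_le_of_mul_eq_zero W Lk horth
  rw [card_Idx, show 2 ^ N * 2 ^ N = 4 ^ N by rw [← mul_pow]; norm_num] at hWL
  linarith

variable [Fintype ι]

/-- **Coherent certificates need `|ι| ≥ (4/3)^{N/2}`:** in the wiring normal form (any sharing or
mixing of columns through the legs `L`, `R`), if any two WIRED blocks of the same copy are
relatively sign-untwisted, then `4^N ≤ |ι|² · 3^N`. -/
theorem four_pow_le_sq_card_mul_three_pow
    (A : ι → Matrix (Idx N) (Idx N) K →ₗ[K] Matrix (Idx N) (Idx N) K) (T : Finset (ι × Idx N))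
    (L : ι → Idx N → (Matrix (Idx N) (Idx N) K →ₗ[K] (Idx N → K)))
    (R : ι → Idx N → ((Idx N → K) →ₗ[K] Matrix (Idx N) (Idx N) K))
    (ident : ∀ X Y : Matrix (Idx N) (Idx N) K,
      ∑ b ∈ T, R b.1 b.2 (Matrix.mulVec (ptrans b.2 (A b.1 X)) (L b.1 b.2 Y)) = X * Y)
    (hRel : ∀ i c c', (i, c) ∈ T → (i, c') ∈ T →
      ∃ ε : K, ∀ X, ptrans (c + c') (A i X) = ε • A i X) :
    4 ^ N ≤ Fintype.card ι ^ 2 * 3 ^ N := by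
  classical
  -- rank and wired-block count of each copy
  let e : ι → ℕ := fun i => Module.finrank K (LinearMap.range (A i))
  let k : ι → ℕ := fun i => (T.filter fun b : ι × Idx N => b.1 = i).card
  -- (1) capacity per copy (coherence)
  have hcap : ∀ i, k i * e i ≤ 6 ^ N := by
    intro i
    have hC : ((T.filter fun b : ι × Idx N => b.1 = i).image Prod.snd).card = k i :=
      Finset.card_image_of_injOn fun b₁ h₁ b₂ h₂ h => by
        simp only [Finset.coe_filter, Set.mem_setOf_eq] at h₁ h₂
        exact Prod.ext (h₁.2.trans h₂.2.symm) h
    have hmem : ∀ c ∈ (T.filter fun b : ι × Idx N => b.1 = i).image Prod.snd, (i, c) ∈ T := by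
      intro c hc
      obtain ⟨⟨i', c'⟩, hb, rfl⟩ := Finset.mem_image.1 hc
      obtain ⟨hT, rfl⟩ := Finset.mem_filter.1 hb
      exact hT
    have h := card_mul_finrank_range_le_of_relative (A i) _ fun c hc c' hc' =>
      hRel i c c' (hmem c hc) (hmem c' hc')
    rwa [hC] at h
  -- (2) the subset constraint at `S = {i : e i ≤ 2^N k i}` gives `4^N ≤ Σ_i min (e i) (2^N k i)`
  let p : ι → Prop := fun i => e i ≤ 2 ^ N * k i
  have h1 := four_pow_le_sum_finrank_add A T L R ident (Finset.univ.filter p)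
  have h2 : (T.filter fun b : ι × Idx N => b.1 ∉ Finset.univ.filter p).card ≤
      ∑ i ∈ Finset.univ.filter (fun i => ¬ p i), k i := by
    have hsub : (T.filter fun b : ι × Idx N => b.1 ∉ Finset.univ.filter p) ⊆
        (Finset.univ.filter fun i => ¬ p i).biUnion (fun i => T.filter fun b : ι × Idx N => b.1 = i) := by
      intro b hb
      simp only [Finset.mem_filter, Finset.mem_univ, true_and] at hb
      simp only [Finset.mem_biUnion, Finset.mem_filter, Finset.mem_univ, true_and]
      exact ⟨b.1, hb.2, hb.1, rfl⟩
    exact (Finset.card_le_card hsub).trans Finset.card_biUnion_le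
  have hmin : ∑ i ∈ Finset.univ.filter p, e i +
      2 ^ N * ∑ i ∈ Finset.univ.filter (fun i => ¬ p i), k i = ∑ i, min (e i) (2 ^ N * k i) := by
    rw [Finset.mul_sum, ← Finset.sum_filter_add_sum_filter_not Finset.univ p]
    congr 1
    · exact Finset.sum_congr rfl fun i hi => (min_eq_left (Finset.mem_filter.1 hi).2).symm
    · exact Finset.sum_congr rfl fun i hi =>
        (min_eq_right (le_of_lt (not_le.1 (Finset.mem_filter.1 hi).2))).symm
  have h3 : 4 ^ N ≤ ∑ i, min (e i) (2 ^ N * k i) := by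
    rw [← hmin]
    exact h1.trans (Nat.add_le_add_left (Nat.mul_le_mul_left _ h2) _)
  -- (3) each `min ≤ √(12^N)` by the capacity bound
  have h4 : ∀ i, min (e i) (2 ^ N * k i) ≤ Nat.sqrt (12 ^ N) := by
    intro i
    rw [Nat.le_sqrt]
    calc min (e i) (2 ^ N * k i) * min (e i) (2 ^ N * k i) ≤ (2 ^ N * k i) * e i :=
          Nat.mul_le_mul (min_le_right _ _) (min_le_left _ _)
      _ = 2 ^ N * (k i * e i) := by ring
      _ ≤ 2 ^ N * 6 ^ N := Nat.mul_le_mul_left _ (hcap i)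
      _ = 12 ^ N := by rw [← mul_pow]; norm_num
  have h5 : 4 ^ N ≤ Fintype.card ι * Nat.sqrt (12 ^ N) := by
    calc 4 ^ N ≤ ∑ i, min (e i) (2 ^ N * k i) := h3
      _ ≤ ∑ _i : ι, Nat.sqrt (12 ^ N) := Finset.sum_le_sum fun i _ => h4 i
      _ = Fintype.card ι * Nat.sqrt (12 ^ N) := by
          rw [Finset.sum_const, Finset.card_univ, smul_eq_mul]
  -- (4) square
  have h6 : 4 ^ N * 4 ^ N ≤ Fintype.card ι ^ 2 * (4 ^ N * 3 ^ N) := by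
    calc 4 ^ N * 4 ^ N
        ≤ (Fintype.card ι * Nat.sqrt (12 ^ N)) * (Fintype.card ι * Nat.sqrt (12 ^ N)) :=
          Nat.mul_le_mul h5 h5
      _ = Fintype.card ι ^ 2 * (Nat.sqrt (12 ^ N) * Nat.sqrt (12 ^ N)) := by ring
      _ ≤ Fintype.card ι ^ 2 * 12 ^ N := Nat.mul_le_mul_left _ (Nat.sqrt_le _)
      _ = Fintype.card ι ^ 2 * (4 ^ N * 3 ^ N) := by rw [← mul_pow]; norm_num
  rw [Nat.mul_left_comm] at h6
  exact Nat.le_of_mul_le_mul_left h6 (pow_pos (by norm_num) N)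

/-- **Extremal reading: below `(4/3)^{N/2}` some copy is incoherent.**  A certificate in wiring
normal form with `|ι|² · 3^N < 4^N` has a copy `i` and two wired blocks `(i,c), (i,c')` whose
readings of the `x`-leg are not proportional (`τ_{c+c'}` is no scalar on `range (A i)`). -/
theorem exists_incoherent_copy_of_lt
    (A : ι → Matrix (Idx N) (Idx N) K →ₗ[K] Matrix (Idx N) (Idx N) K) (T : Finset (ι × Idx N))
    (L : ι → Idx N → (Matrix (Idx N) (Idx N) K →ₗ[K] (Idx N → K)))
    (R : ι → Idx N → ((Idx N → K) →ₗ[K] Matrix (Idx N) (Idx N) K))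
    (ident : ∀ X Y : Matrix (Idx N) (Idx N) K,
      ∑ b ∈ T, R b.1 b.2 (Matrix.mulVec (ptrans b.2 (A b.1 X)) (L b.1 b.2 Y)) = X * Y)
    (hlt : Fintype.card ι ^ 2 * 3 ^ N < 4 ^ N) :
    ∃ i c c', (i, c) ∈ T ∧ (i, c') ∈ T ∧
      ∀ ε : K, ∃ X, ptrans (c + c') (A i X) ≠ ε • A i X := by
  by_contra h
  simp only [not_exists, not_and, not_forall, ne_eq, not_not] at h
  exact absurd (four_pow_le_sq_card_mul_three_pow A T L R ident
    fun i c c' hc hc' => h i c c' hc hc') (not_le.2 hlt)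

/-- **Rate form:** `4^N ≤ B² · 3^N` with `B ≥ 1` gives `N · log(4/3) ≤ 2 · log B`, i.e. coherent
certificate families have exchange rate at least `½ · log₂(4/3) = 0.2075… > 0` — they cannot
witness `BlockOneIsMM` (`θ⋆ = 0`). -/
theorem coherent_rate {N B : ℕ} (hB : 1 ≤ B) (h : 4 ^ N ≤ B ^ 2 * 3 ^ N) :
    (N : ℝ) * Real.log (4 / 3) ≤ 2 * Real.log B := by
  have h' : (4 : ℝ) ^ N ≤ (B : ℝ) ^ 2 * 3 ^ N := by exact_mod_cast h
  have hB' : (0 : ℝ) < B := by exact_mod_cast hB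
  have hlog := Real.log_le_log (by positivity) h'
  rw [Real.log_pow, Real.log_mul (by positivity) (by positivity), Real.log_pow, Real.log_pow] at hlog
  push_cast at hlog
  rw [Real.log_div (by norm_num) (by norm_num), mul_sub]
  linarith

/-- **Numerics.**  One coherent copy never suffices (`N ≥ 1`); at `N = 5` a coherent certificate
needs `B ≥ 3` (`4 · 243 < 1024 ≤ 9 · 243`), at `N = 8` it needs `B ≥ 4`
(`9 · 6561 < 65536 ≤ 16 · 6561`) — against the attained column-disjoint values `5` and `10`
(census I75) and the general floor `B ≥ 2`. -/
theorem coherent_numerics :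
    (∀ N : ℕ, 1 ≤ N → ¬ 4 ^ N ≤ 1 ^ 2 * 3 ^ N) ∧
      (¬ 4 ^ 5 ≤ 2 ^ 2 * 3 ^ 5 ∧ 4 ^ 5 ≤ 3 ^ 2 * 3 ^ 5) ∧
      (¬ 4 ^ 8 ≤ 3 ^ 2 * 3 ^ 8 ∧ 4 ^ 8 ≤ 4 ^ 2 * 3 ^ 8) := by
  refine ⟨fun N hN => ?_, by norm_num, by norm_num⟩
  rw [one_pow, one_mul, not_le]
  exact Nat.pow_lt_pow_left (by norm_num) (by omega)

end Summit.MatrixMultiplication.MatrixMultiplication.Theorems.OutsiderSandwichCoherentSharing
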